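import Summits.AtomisticToContinuum.Crystallization.Theorems.FrustratedLawDichotomyStrainedPatchHomEntryLeafHTUCell095h
import Summits.AtomisticToContinuum.Crystallization.Theorems.FrustratedLawDichotomyStrainedPatchHomEntryLeafHTUCentredRot
import Summits.AtomisticToContinuum.Crystallization.Theorems.FrustratedLawDichotomyStrainedPatchHomEntryLeafHTCentredRotMustPass

/-!
# The `0.95 t_b` cell at entry half-width `2⁻¹³` closes END TO END with the certificate OF RECORD and ONE inner leaf of the centred rotated verdict
# (27623 `(H) HomFloor (1/625)`, hcp half; hand-1 g32; critic row 1236 (ii) «inner-leaf multiplicity m at 2⁻¹³»)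

decomp-a2c hand-1 g32 (crux `AperiodicFrustratedLawGap`, stmt-AtomisticToContinuum-27623).  Cell `cX95h × wXh` (`…Cross095hA`, entry half-width `2⁻¹³`) with its
certificate of record `pX95h`; the fused one-fact certificate side `…HTUCell095h.htCertSideU_X95h` (102 s at the gate).  hand-1 g31 had left the inner tree of
this cell multi-leaf (naive rotated verdict, > 16 leaves hit the kernel memory ceiling); with the CENTRED rotated verdict of `…CentredRotSound` and the
`0.95 t_b` rotation payload `qX95c` ONE inner leaf closes the whole confined box (KERNEL `treeOKUCR_X95h`), so ★★ `entryLeafOKHT4UQDCR_X95h`: the cell closes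
end to end through the reduced-universe leaf — `m = 1` at `2⁻¹³` as at `2⁻¹²`.

Kernel fact + assembly; 0 sorry; no definitions; standard axioms.  `--supports stmt-AtomisticToContinuum-27623`.
-/

namespace Summit.AtomisticToContinuum.Crystallization.Theorems.FrustratedLawDichotomyStrainedPatchHomEntryLeafHT

open Literature.Analysis.ValidatedNumerics.Numerics
open Summit.AtomisticToContinuum.Crystallization.Theorems.FrustratedLawDichotomyStrainedPatchHomCertTree (CertTree treeOK)
open Summit.AtomisticToContinuum.Crystallization.Theorems.FrustratedLawDichotomyStrainedPatchHomEntryTable (muRec)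
open Summit.AtomisticToContinuum.Crystallization.Theorems.FrustratedLawDichotomyStrainedPatchHomEntryFitHcpCentred (entryLeafOKHQDCR)

set_option maxRecDepth 100000 in
set_option maxHeartbeats 4000000 in
/-- ★ KERNEL: ONE inner leaf of the centred rotated verdict (payload `qX95c`) closes the whole confined box of the `2⁻¹³` cell at `0.95 t_b`. -/
theorem treeOKUCR_X95h : treeOK (entryLeafOKHQDCR muRec qX95c) CertTree.leaf cX95h (htWr pX95h cX95h wXh) = true := by
  decide +kernel

/-- ★★ **THE `2⁻¹³` CELL AT `0.95 t_b` CLOSES END TO END** with the certificate of record and one inner leaf. [assembly by rewriting] -/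
theorem entryLeafOKHT4UQDCR_X95h : entryLeafOKHT4UQDCR muRec qX95c pX95h CertTree.leaf cX95h wXh = true := by
  have h1 := htCertSideU_X95h
  have h2 := treeOKUCR_X95h
  unfold entryLeafOKHT4UQDCR entryLeafOKHT4U
  rw [h1, h2]
  rfl

end Summit.AtomisticToContinuum.Crystallization.Theorems.FrustratedLawDichotomyStrainedPatchHomEntryLeafHT
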